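import Literature.Analysis.TotalPositivity.PolyaFrequencyFunctionsProofs
import Literature.Analysis.TotalPositivity.PolyaFrequencyConvolution
import Literature.Analysis.TotalPositivity.PolyaFrequencyGaussian
import Mathlib.LinearAlgebra.Matrix.AbsoluteValue
import HarnessLib

/-!
# Strict total positivity of the Gauss kernel (Schoenberg 1951, necessity half, step N2a)

Trunk `Literature/Analysis/TotalPositivity`, ninth proofs file accompanying
`PolyaFrequencyFunctions.lean` (the named fact `schoenberg1951_pf_laplace`).  For the necessity
half of Schoenberg's theorem one smooths a Pólya frequency function by a Gaussian to obtain
STRICTLY totally positive kernels (Karlin's device); this file supplies the strict total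
positivity of the Gauss kernel itself:

> `det ‖e^{−a(x_i − y_j)²}‖ > 0` for `a > 0` and strictly increasing `x, y`
> (`translationMinor_gaussian_pos`), and `det ‖e^{x_i y_j}‖ > 0` (`det_exp_mul_pos`)

[Karlin1968, Ch. 3, §1 (c): the kernels `e^{xy}` and `e^{−(x−y)²}` are strictly totally
positive].  Instead of the classical proof by generalised Descartes' rule (zero counting for
exponential sums), we use the semigroup property `G_{2a} ⋆ G_{2a} = √(π/4a) · G_a` and the basic
composition formula (`factorial_mul_translationMinor_conv`, PolyaFrequencyConvolution.lean):
`n! det ‖(G_{2a} ⋆ G_{2a})(x_i − y_j)‖ = ∫_{ℝⁿ} det ‖G_{2a}(x_i − s_j)‖ det ‖G_{2a}(s_i − y_j)‖ ds`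
has a continuous, pointwise non-negative (`translationMinor_mul_nonneg`) integrand which at
`s = (0, 1, …, n − 1)` is a product of two positive multiples of Vandermonde determinants in the
increasing nodes `e^{4a x_i}`, `e^{4a y_j}`, hence positive; so the integral is positive.

## References

* S. Karlin, *Total Positivity* I (1968), Ch. 3 §1 (c). [Karlin1968]
* I. J. Schoenberg, *On Pólya frequency functions. I*, J. Analyse Math. 1 (1951) 331–374, §1, §6.
  [Schoenberg1951]
-/

noncomputable section

open MeasureTheory Set Filter Finset
open scoped Topology

namespace Literature.Analysis.TotalPositivity

/-! ### The Gaussian semigroup -/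

/-- **`G_a ⋆ G_a = √(π/2a) G_{a/2}`**: `∫ e^{−at²} e^{−a(u−t)²} dt = √(π/(2a)) e^{−(a/2)u²}`.
[folklore] -/
theorem integral_gaussian_mul_gaussian {a : ℝ} (u : ℝ) :
    ∫ t, Real.exp (-a * t ^ 2) * Real.exp (-a * (u - t) ^ 2) =
      Real.sqrt (Real.pi / (2 * a)) * Real.exp (-(a / 2) * u ^ 2) := by
  have hfun : (fun t : ℝ => Real.exp (-a * t ^ 2) * Real.exp (-a * (u - t) ^ 2)) =
      fun t : ℝ => Real.exp (-(a / 2) * u ^ 2) *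
        (fun v : ℝ => Real.exp (-(2 * a) * v ^ 2)) (t - u / 2) := by
    funext t
    simp only
    rw [← Real.exp_add, ← Real.exp_add]
    congr 1
    ring
  rw [hfun, integral_const_mul, integral_sub_right_eq_self (fun v : ℝ => Real.exp (-(2 * a) * v ^ 2)),
    integral_gaussian, mul_comm]

/-! ### Vandermonde values of the Gaussian minors at integer nodes -/

/-- At the integer nodes `s_j = j` a Gaussian minor is a positive multiple of a Vandermonde
determinant: `det ‖e^{−a(x_i − j)²}‖ > 0` for strictly increasing `x` and `a > 0`. [folklore] -/
theorem translationMinor_gaussian_natCast_pos {a : ℝ} (ha : 0 < a) {n : ℕ} {x : Fin n → ℝ}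
    (hx : StrictMono x) :
    0 < translationMinor (fun u => Real.exp (-a * u ^ 2)) x (fun j : Fin n => ((j : ℕ) : ℝ)) := by
  unfold translationMinor
  set v : Fin n → ℝ := fun i => Real.exp (2 * a * x i) with hv
  have hvmono : StrictMono v := fun i j hij => Real.exp_lt_exp.2 (by nlinarith [hx hij])
  have hfac : (Matrix.of fun i j : Fin n => Real.exp (-a * (x i - ((j : ℕ) : ℝ)) ^ 2)) =
      Matrix.of fun i j : Fin n => Real.exp (-a * x i ^ 2) *
        (Matrix.of fun i j : Fin n => Real.exp (-a * ((j : ℕ) : ℝ) ^ 2) *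
          Matrix.vandermonde v i j) i j := by
    ext i j
    simp only [Matrix.of_apply, Matrix.vandermonde_apply, hv]
    rw [← Real.exp_nat_mul, ← Real.exp_add, ← Real.exp_add]
    congr 1
    ring
  rw [hfac, Matrix.det_mul_column, Matrix.det_mul_row, Matrix.det_vandermonde]
  refine mul_pos (prod_pos fun i _ => Real.exp_pos _) (mul_pos (prod_pos fun i _ => Real.exp_pos _) ?_)
  refine prod_pos fun i _ => prod_pos fun j hj => ?_
  rw [Finset.mem_Ioi] at hj
  exact sub_pos.2 (hvmono hj)

/-- The transposed version: `det ‖e^{−a(i − y_j)²}‖ > 0` for strictly increasing `y`, `a > 0`.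
[folklore] -/
theorem translationMinor_gaussian_natCast_pos' {a : ℝ} (ha : 0 < a) {n : ℕ} {y : Fin n → ℝ}
    (hy : StrictMono y) :
    0 < translationMinor (fun u => Real.exp (-a * u ^ 2)) (fun i : Fin n => ((i : ℕ) : ℝ)) y := by
  unfold translationMinor
  set w : Fin n → ℝ := fun j => Real.exp (2 * a * y j) with hw
  have hwmono : StrictMono w := fun i j hij => Real.exp_lt_exp.2 (by nlinarith [hy hij])
  have hfac : (Matrix.of fun i j : Fin n => Real.exp (-a * (((i : ℕ) : ℝ) - y j) ^ 2)) =
      Matrix.of fun i j : Fin n => Real.exp (-a * ((i : ℕ) : ℝ) ^ 2) *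
        (Matrix.of fun i j : Fin n => Real.exp (-a * y j ^ 2) *
          (Matrix.vandermonde w).transpose i j) i j := by
    ext i j
    simp only [Matrix.of_apply, Matrix.transpose_apply, Matrix.vandermonde_apply, hw]
    rw [← Real.exp_nat_mul, ← Real.exp_add, ← Real.exp_add]
    congr 1
    ring
  rw [hfac, Matrix.det_mul_column, Matrix.det_mul_row, Matrix.det_transpose, Matrix.det_vandermonde]
  refine mul_pos (prod_pos fun i _ => Real.exp_pos _) (mul_pos (prod_pos fun i _ => Real.exp_pos _) ?_)
  refine prod_pos fun i _ => prod_pos fun j hj => ?_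
  rw [Finset.mem_Ioi] at hj
  exact sub_pos.2 (hwmono hj)

/-! ### Strict total positivity -/

/-- Integrability of the composition integrand for a Gaussian: the function
`s ↦ det ‖G(x_i − s_j)‖ · det ‖G(s_i − y_j)‖`, `G = e^{−b(·)²}`, is integrable on `ℝⁿ`
(the first factor is a signed sum of products of one-variable Gaussians, the second is bounded
by `n!`). [folklore] -/
theorem integrable_gaussMinor_mul {b : ℝ} (hb : 0 < b) {n : ℕ} (x y : Fin n → ℝ) :
    Integrable fun S : Fin n → ℝ =>
      translationMinor (fun u => Real.exp (-b * u ^ 2)) x S *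
        translationMinor (fun u => Real.exp (-b * u ^ 2)) S y := by
  classical
  set G : ℝ → ℝ := fun u => Real.exp (-b * u ^ 2) with hG
  -- a dominating integrable function
  set F : (Fin n → ℝ) → ℝ := fun S => ∑ σ : Equiv.Perm (Fin n), ∏ i, G (x (σ i) - S i) with hF
  have hGi : Integrable G := by simpa [hG] using integrable_exp_neg_mul_sq hb
  have hFi : Integrable F := by
    refine integrable_finsetSum _ fun σ _ => ?_
    exact Integrable.fintype_prod (f := fun i s => G (x (σ i) - s)) fun i => hGi.comp_sub_left _
  have hcont : Continuous fun S : Fin n → ℝ =>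
      translationMinor G x S * translationMinor G S y := by
    unfold translationMinor
    refine Continuous.mul ?_ ?_
    · refine Continuous.matrix_det (continuous_matrix fun i j => ?_)
      simp only [Matrix.of_apply, hG]
      fun_prop
    · refine Continuous.matrix_det (continuous_matrix fun i j => ?_)
      simp only [Matrix.of_apply, hG]
      fun_prop
  refine (hFi.const_mul (Nat.factorial n : ℝ)).mono' hcont.aestronglyMeasurable
    (Eventually.of_forall fun S => ?_)
  rw [Real.norm_eq_abs, abs_mul]
  -- bound the two factors
  have h1 : |translationMinor G x S| ≤ F S := by
    unfold translationMinor
    rw [Matrix.det_apply', hF]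
    refine (Finset.abs_sum_le_sum_abs _ _).trans (Finset.sum_le_sum fun σ _ => ?_)
    rw [abs_mul, Finset.abs_prod]
    have hsign : |((Equiv.Perm.sign σ : ℤ) : ℝ)| = 1 := by
      rcases Int.units_eq_one_or (Equiv.Perm.sign σ) with h | h <;> simp [h]
    rw [hsign, one_mul]
    refine le_of_eq (Finset.prod_congr rfl fun i _ => ?_)
    simp only [Matrix.of_apply]
    exact abs_of_nonneg (Real.exp_pos _).le
  have h2 : |translationMinor G S y| ≤ (Nat.factorial n : ℝ) := by
    unfold translationMinor
    have h := Matrix.det_le (abv := AbsoluteValue.abs) (A := Matrix.of fun i j : Fin n => G (S i - y j))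
      (x := (1 : ℝ)) fun i j => by
        simp only [Matrix.of_apply, AbsoluteValue.abs_apply, hG]
        rw [abs_of_nonneg (Real.exp_pos _).le]
        exact Real.exp_le_one_iff.2 (by nlinarith [sq_nonneg (S i - y j)])
    simpa [Fintype.card_fin] using h
  have hF0 : 0 ≤ F S := hF ▸ Finset.sum_nonneg fun σ _ => Finset.prod_nonneg fun i _ => (Real.exp_pos _).le
  calc |translationMinor G x S| * |translationMinor G S y| ≤ F S * (Nat.factorial n : ℝ) :=
        mul_le_mul h1 h2 (abs_nonneg _) hF0
    _ = (Nat.factorial n : ℝ) * F S := mul_comm _ _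

/-- **The Gauss kernel is strictly totally positive** (Karlin): for `a > 0` and strictly
increasing `x, y : Fin n → ℝ`, `det ‖e^{−a(x_i − y_j)²}‖ > 0`.  Semigroup property + basic
composition formula: `n! det ‖(G_{2a} ⋆ G_{2a})(x_i − y_j)‖ = ∫ det ‖G_{2a}(x_i − s_j)‖ det ‖G_{2a}(s_i − y_j)‖ ds`
with a continuous non-negative integrand, positive at `s = (0, 1, …, n−1)`.
[cite: Karlin1968, Ch. 3 §1 (c)] -/
theorem translationMinor_gaussian_pos {a : ℝ} (ha : 0 < a) {n : ℕ} {x y : Fin n → ℝ}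
    (hx : StrictMono x) (hy : StrictMono y) :
    0 < translationMinor (fun u => Real.exp (-a * u ^ 2)) x y := by
  classical
  set b : ℝ := 2 * a with hb_def
  have hb : 0 < b := by positivity
  set G : ℝ → ℝ := fun u => Real.exp (-b * u ^ 2) with hG
  have hGpf : IsPolyaFrequencyFun G := by
    simpa [hG] using isPolyaFrequencyFun_gaussian hb one_pos
  -- the convolution `G ⋆ G` is a positive multiple of the Gaussian of parameter `a`
  have hconv : (fun u => ∫ t, G t * G (u - t)) =
      fun u => Real.sqrt (Real.pi / (2 * b)) * Real.exp (-a * u ^ 2) := by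
    funext u
    rw [hG]
    simp only
    rw [integral_gaussian_mul_gaussian]
    congr 2
    rw [hb_def]
    ring
  have hκ : 0 < Real.sqrt (Real.pi / (2 * b)) := Real.sqrt_pos.2 (by positivity)
  -- composition formula
  have hcomp := factorial_mul_translationMinor_conv G G hGpf.integrable hGpf.measurable
    (C := 1) (fun u => by
      rw [hG]
      simp only
      rw [abs_of_nonneg (Real.exp_pos _).le]
      exact Real.exp_le_one_iff.2 (by nlinarith [sq_nonneg u])) x y
  rw [hconv, translationMinor_const_mul] at hcomp
  -- positivity of the integral
  set Φ : (Fin n → ℝ) → ℝ := fun S => translationMinor G x S * translationMinor G S y with hΦ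
  have hΦi : Integrable Φ := integrable_gaussMinor_mul hb x y
  have hΦ0 : ∀ S, 0 ≤ Φ S := fun S => translationMinor_mul_nonneg hGpf hGpf hx hy S
  have hΦc : Continuous Φ := by
    rw [hΦ]
    unfold translationMinor
    refine Continuous.mul ?_ ?_
    · refine Continuous.matrix_det (continuous_matrix fun i j => ?_)
      simp only [Matrix.of_apply, hG]
      fun_prop
    · refine Continuous.matrix_det (continuous_matrix fun i j => ?_)
      simp only [Matrix.of_apply, hG]
      fun_prop
  set S₀ : Fin n → ℝ := fun j => ((j : ℕ) : ℝ) with hS₀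
  have hΦpos : 0 < Φ S₀ :=
    mul_pos (translationMinor_gaussian_natCast_pos hb hx) (translationMinor_gaussian_natCast_pos' hb hy)
  have hint : 0 < ∫ S, Φ S := by
    rw [integral_pos_iff_support_of_nonneg hΦ0 hΦi]
    -- the support contains an open neighbourhood of `S₀`
    have hopen : IsOpen (Φ ⁻¹' Set.Ioi 0) := hΦc.isOpen_preimage _ isOpen_Ioi
    have hsub : Φ ⁻¹' Set.Ioi 0 ⊆ Function.support Φ := fun S hS => ne_of_gt hS
    exact (hopen.measure_pos volume ⟨S₀, hΦpos⟩).trans_le (measure_mono hsub)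
  -- conclude
  have hfin : 0 < Real.sqrt (Real.pi / (2 * b)) ^ n *
      translationMinor (fun u => Real.exp (-a * u ^ 2)) x y := by
    have h := hcomp
    have hn : (0 : ℝ) < Nat.factorial n := by positivity
    have : 0 < (Nat.factorial n : ℝ) * (Real.sqrt (Real.pi / (2 * b)) ^ n *
        translationMinor (fun u => Real.exp (-a * u ^ 2)) x y) := by
      rw [h]
      exact hint
    exact (mul_pos_iff_of_pos_left hn).1 this
  exact (mul_pos_iff_of_pos_left (pow_pos hκ n)).1 hfin

/-- Strict total positivity of positive multiples of Gaussians. [cite: Karlin1968, Ch. 3 §1 (c)] -/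
theorem translationMinor_gaussian_pos' {a c : ℝ} (ha : 0 < a) (hc : 0 < c) {n : ℕ} {x y : Fin n → ℝ}
    (hx : StrictMono x) (hy : StrictMono y) :
    0 < translationMinor (fun u => c * Real.exp (-a * u ^ 2)) x y := by
  rw [translationMinor_const_mul]
  exact mul_pos (pow_pos hc n) (translationMinor_gaussian_pos ha hx hy)

/-- **The kernel `e^{xy}` is strictly totally positive**: `det ‖e^{x_i y_j}‖ > 0` for strictly
increasing real `x, y` (from the Gaussian: `e^{−(x−y)²/2} = e^{−x²/2} e^{xy} e^{−y²/2}`).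
[cite: Karlin1968, Ch. 3 §1 (c)] -/
theorem det_exp_mul_pos {n : ℕ} {x y : Fin n → ℝ} (hx : StrictMono x) (hy : StrictMono y) :
    0 < (Matrix.of fun i j : Fin n => Real.exp (x i * y j)).det := by
  have h := translationMinor_gaussian_pos (a := 1 / 2) (by norm_num) hx hy
  unfold translationMinor at h
  have hfac : (Matrix.of fun i j : Fin n => Real.exp (-(1 / 2) * (x i - y j) ^ 2)) =
      Matrix.of fun i j : Fin n => Real.exp (-(1 / 2) * x i ^ 2) *
        (Matrix.of fun i j : Fin n => Real.exp (-(1 / 2) * y j ^ 2) *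
          (Matrix.of fun i j : Fin n => Real.exp (x i * y j)) i j) i j := by
    ext i j
    simp only [Matrix.of_apply]
    rw [← Real.exp_add, ← Real.exp_add]
    congr 1
    ring
  rw [hfac, Matrix.det_mul_column, Matrix.det_mul_row] at h
  have h1 : 0 < ∏ i : Fin n, Real.exp (-(1 / 2) * x i ^ 2) := prod_pos fun i _ => Real.exp_pos _
  have h2 : 0 < ∏ j : Fin n, Real.exp (-(1 / 2) * y j ^ 2) := prod_pos fun i _ => Real.exp_pos _
  exact (mul_pos_iff_of_pos_left h2).1 ((mul_pos_iff_of_pos_left h1).1 h)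

end Literature.Analysis.TotalPositivity

end
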